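import Mathlib
import Summits.AtomisticToContinuum.HydrodynamicLimit.Theorems.OneSphereInfluenceStaticScoreResponseLogPartitionDeriv
import HarnessLib

/-!
# `StaticScoreResponse` (support item stmt-AtomisticToContinuum-12269): the finite-`n` score
# identity with a parameter-dependent observable

Product-rule extension of `hasDerivAt_integral_posGibbsMeasure` (`LogPartitionDeriv`): along a
differentiable path of positive activities `κ ↦ a κ` and for a bounded family of observables
`F κ` differentiable in `κ` with bounded derivative `F' κ`,

`d/dκ|_{κ₀} E_{a_κ}[F_κ] = E_{a_{κ₀}}[F'_{κ₀}] + (E_{a_{κ₀}}[F_{κ₀} S] - E_{a_{κ₀}}[F_{κ₀}] E_{a_{κ₀}}[S])`,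

`S = ∑ᵢ a'_{κ₀}(xᵢ)/a_{κ₀}(xᵢ)` the score (`hasDerivAt_integral_posGibbsMeasure_param`): the mean of the
`κ`-derivative of the observable plus its covariance with the score. This is the identity behind
`StaticScoreResponse`: the covariance of a hydrodynamic field with the score of the local Gibbs
family is the derivative of its mean minus the mean of its derivative. Folklore; no definitions, no
named facts.
-/

noncomputable section

namespace Summit.AtomisticToContinuum.HydrodynamicLimit.Theorems

open Finset MeasureTheory Metric Set Filter Topology
  Literature.MathematicalPhysics.KineticTheory

variable {n : ℕ}

/-- `|posWeight a ε n x| ≤ Cⁿ` when `|a| ≤ C`. [folklore] -/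
theorem abs_posWeight_le {a : T3 → ℝ} {C : ℝ} (hC : 0 ≤ C) (ha : ∀ y, |a y| ≤ C) (ε : ℝ) (x : Fin n → T3) :
    |posWeight a ε n x| ≤ C ^ n := by
  rw [posWeight]
  by_cases hx : x ∈ posDomain ε n
  · rw [Set.indicator_of_mem hx]
    calc |∏ i, a (x i)| = ∏ i, |a (x i)| := Finset.abs_prod _ _
      _ ≤ ∏ _i : Fin n, C := Finset.prod_le_prod (fun i _ => abs_nonneg _) fun i _ => ha _
      _ = C ^ n := by simp
  · rw [Set.indicator_of_notMem hx, abs_zero]; positivity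

/-- `|𝟙_{no overlap} ∑ᵢ a'(xᵢ) ∏_{j≠i} a(xⱼ)| ≤ n Cⁿ` when `|a|, |a'| ≤ C`. [folklore] -/
theorem abs_indicator_sum_mul_prod_erase_le {a a' : T3 → ℝ} {C : ℝ} (hC : 0 ≤ C) (ha : ∀ y, |a y| ≤ C)
    (ha' : ∀ y, |a' y| ≤ C) (ε : ℝ) (x : Fin n → T3) :
    |(posDomain ε n).indicator (fun x => ∑ i, a' (x i) * ∏ j ∈ univ.erase i, a (x j)) x| ≤ n * C ^ n := by
  by_cases hx : x ∈ posDomain ε n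
  · rw [Set.indicator_of_mem hx]
    exact abs_sum_mul_prod_erase_le hC ha ha' x
  · rw [Set.indicator_of_notMem hx, abs_zero]; positivity

/-- **Differentiation under the integral sign with a parameter-dependent observable** (product
rule): `d/dκ|_{κ₀} ∫ F_κ posWeight(a_κ) = ∫ (F'_{κ₀} posWeight(a_{κ₀}) + F_{κ₀} ∂_κ posWeight(a_κ)|_{κ₀})`.
[folklore] -/
theorem hasDerivAt_integral_mul_posWeight_param {a a' : ℝ → T3 → ℝ} {F F' : ℝ → (Fin n → T3) → ℝ}
    {κ₀ r C K : ℝ} (hr : 0 < r) (hC : 0 ≤ C) (hK : 0 ≤ K)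
    (ha_cont : ∀ κ ∈ ball κ₀ r, Continuous (a κ)) (ha'_cont : ∀ κ ∈ ball κ₀ r, Continuous (a' κ))
    (hderiv : ∀ κ ∈ ball κ₀ r, ∀ y, HasDerivAt (fun κ => a κ y) (a' κ y) κ)
    (hbd : ∀ κ ∈ ball κ₀ r, ∀ y, |a κ y| ≤ C) (hbd' : ∀ κ ∈ ball κ₀ r, ∀ y, |a' κ y| ≤ C)
    (hFm : ∀ κ ∈ ball κ₀ r, Measurable (F κ)) (hF'm : ∀ κ ∈ ball κ₀ r, Measurable (F' κ))
    (hFK : ∀ κ ∈ ball κ₀ r, ∀ x, |F κ x| ≤ K) (hF'K : ∀ κ ∈ ball κ₀ r, ∀ x, |F' κ x| ≤ K)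
    (hFd : ∀ κ ∈ ball κ₀ r, ∀ x, HasDerivAt (fun κ => F κ x) (F' κ x) κ) (ε : ℝ) :
    HasDerivAt (fun κ => ∫ x, F κ x * posWeight (a κ) ε n x)
      (∫ x, F' κ₀ x * posWeight (a κ₀) ε n x + F κ₀ x * (posDomain ε n).indicator
        (fun x => ∑ i, a' κ₀ (x i) * ∏ j ∈ univ.erase i, a κ₀ (x j)) x) κ₀ := by
  have hball : ball κ₀ r ∈ 𝓝 κ₀ := ball_mem_nhds κ₀ hr
  have hκ₀ : κ₀ ∈ ball κ₀ r := mem_ball_self hr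
  -- measurability of the derivative of the weight
  have hDm : ∀ κ ∈ ball κ₀ r, Measurable fun x : Fin n → T3 => (posDomain ε n).indicator
      (fun x => ∑ i, a' κ (x i) * ∏ j ∈ univ.erase i, a κ (x j)) x := by
    intro κ hκ
    refine (Finset.measurable_sum _ fun i _ => ?_).indicator (measurableSet_posDomain ε n)
    exact ((ha'_cont κ hκ).measurable.comp (measurable_pi_apply i)).mul
      (Finset.measurable_prod _ fun j _ => (ha_cont κ hκ).measurable.comp (measurable_pi_apply j))
  have key := hasDerivAt_integral_of_dominated_loc_of_deriv_le (𝕜 := ℝ)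
    (μ := (volume : Measure (Fin n → T3))) (x₀ := κ₀) (s := ball κ₀ r)
    (F := fun κ x => F κ x * posWeight (a κ) ε n x)
    (F' := fun κ x => F' κ x * posWeight (a κ) ε n x + F κ x * (posDomain ε n).indicator
      (fun x => ∑ i, a' κ (x i) * ∏ j ∈ univ.erase i, a κ (x j)) x)
    (bound := fun _ => K * C ^ n + K * (n * C ^ n)) hball ?_ ?_ ?_ ?_ (integrable_const _) ?_
  · exact key.2
  · -- measurability of `F κ · posWeight(a κ)` near `κ₀`
    filter_upwards [hball] with κ hκ
    exact ((hFm κ hκ).mul (measurable_posWeight (ha_cont κ hκ) ε n)).aestronglyMeasurable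
  · -- integrability at `κ₀`
    refine Integrable.mono' (integrable_const (K * C ^ n))
      ((hFm κ₀ hκ₀).mul (measurable_posWeight (ha_cont κ₀ hκ₀) ε n)).aestronglyMeasurable
      (ae_of_all _ fun x => ?_)
    rw [Real.norm_eq_abs, abs_mul]
    exact mul_le_mul (hFK κ₀ hκ₀ x) (abs_posWeight_le hC (hbd κ₀ hκ₀) ε x) (abs_nonneg _) hK
  · exact (((hF'm κ₀ hκ₀).mul (measurable_posWeight (ha_cont κ₀ hκ₀) ε n)).add
      ((hFm κ₀ hκ₀).mul (hDm κ₀ hκ₀))).aestronglyMeasurable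
  · -- the uniform bound on the derivative integrand
    refine ae_of_all _ fun x κ hκ => ?_
    rw [Real.norm_eq_abs]
    calc |F' κ x * posWeight (a κ) ε n x + F κ x * (posDomain ε n).indicator
            (fun x => ∑ i, a' κ (x i) * ∏ j ∈ univ.erase i, a κ (x j)) x|
        ≤ |F' κ x * posWeight (a κ) ε n x| + |F κ x * (posDomain ε n).indicator
            (fun x => ∑ i, a' κ (x i) * ∏ j ∈ univ.erase i, a κ (x j)) x| := abs_add_le _ _
      _ ≤ K * C ^ n + K * (n * C ^ n) := by
          rw [abs_mul, abs_mul]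
          exact add_le_add (mul_le_mul (hF'K κ hκ x) (abs_posWeight_le hC (hbd κ hκ) ε x) (abs_nonneg _) hK)
            (mul_le_mul (hFK κ hκ x) (abs_indicator_sum_mul_prod_erase_le hC (hbd κ hκ) (hbd' κ hκ) ε x)
              (abs_nonneg _) hK)
  · -- pointwise differentiability (product rule)
    refine ae_of_all _ fun x κ hκ => ?_
    exact (hFd κ hκ x).mul (hasDerivAt_posWeight ε x (hderiv κ hκ))

/-- **The finite-`n` score identity with a parameter-dependent observable.** Along a differentiable
path of positive activities `a κ` (with `Z(a_{κ₀}) > 0`) and for a bounded family of observables `F κ`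
differentiable in `κ` with bounded derivative `F' κ`:
`d/dκ|_{κ₀} E_{a_κ}[F_κ] = E[F'_{κ₀}] + (E[F_{κ₀} S] - E[F_{κ₀}] E[S])` under `posGibbsMeasure (a κ₀) ε n`,
`S = ∑ᵢ a'_{κ₀}(xᵢ)/a_{κ₀}(xᵢ)`. [folklore] -/
theorem hasDerivAt_integral_posGibbsMeasure_param {a a' : ℝ → T3 → ℝ} {F F' : ℝ → (Fin n → T3) → ℝ}
    {κ₀ r C K : ℝ} (hr : 0 < r) (hC : 0 ≤ C) (hK : 0 ≤ K)
    (ha_cont : ∀ κ ∈ ball κ₀ r, Continuous (a κ)) (ha'_cont : ∀ κ ∈ ball κ₀ r, Continuous (a' κ))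
    (hderiv : ∀ κ ∈ ball κ₀ r, ∀ y, HasDerivAt (fun κ => a κ y) (a' κ y) κ)
    (hbd : ∀ κ ∈ ball κ₀ r, ∀ y, |a κ y| ≤ C) (hbd' : ∀ κ ∈ ball κ₀ r, ∀ y, |a' κ y| ≤ C)
    (hnn : ∀ κ ∈ ball κ₀ r, ∀ y, 0 ≤ a κ y) (hpos : ∀ y, 0 < a κ₀ y) {ε : ℝ}
    (hZ : 0 < posPartition (a κ₀) ε n)
    (hFm : ∀ κ ∈ ball κ₀ r, Measurable (F κ)) (hF'm : ∀ κ ∈ ball κ₀ r, Measurable (F' κ))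
    (hFK : ∀ κ ∈ ball κ₀ r, ∀ x, |F κ x| ≤ K) (hF'K : ∀ κ ∈ ball κ₀ r, ∀ x, |F' κ x| ≤ K)
    (hFd : ∀ κ ∈ ball κ₀ r, ∀ x, HasDerivAt (fun κ => F κ x) (F' κ x) κ) :
    HasDerivAt (fun κ => ∫ x, F κ x ∂posGibbsMeasure (a κ) ε n)
      ((∫ x, F' κ₀ x ∂posGibbsMeasure (a κ₀) ε n) +
        ((∫ x, F κ₀ x * ∑ i, a' κ₀ (x i) / a κ₀ (x i) ∂posGibbsMeasure (a κ₀) ε n) -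
          (∫ x, F κ₀ x ∂posGibbsMeasure (a κ₀) ε n) *
            ∫ x, ∑ i, a' κ₀ (x i) / a κ₀ (x i) ∂posGibbsMeasure (a κ₀) ε n)) κ₀ := by
  have hball : ball κ₀ r ∈ 𝓝 κ₀ := ball_mem_nhds κ₀ hr
  have hκ₀ : κ₀ ∈ ball κ₀ r := mem_ball_self hr
  -- the numerator
  have hN := hasDerivAt_integral_mul_posWeight_param hr hC hK ha_cont ha'_cont hderiv hbd hbd' hFm hF'm hFK hF'K hFd ε
  -- split and rewrite its derivative in score form
  have i1 : Integrable (fun x : Fin n → T3 => F' κ₀ x * posWeight (a κ₀) ε n x) :=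
    Integrable.mono' (integrable_const (K * C ^ n))
      ((hF'm κ₀ hκ₀).mul (measurable_posWeight (ha_cont κ₀ hκ₀) ε n)).aestronglyMeasurable
      (ae_of_all _ fun x => by
        rw [Real.norm_eq_abs, abs_mul]
        exact mul_le_mul (hF'K κ₀ hκ₀ x) (abs_posWeight_le hC (hbd κ₀ hκ₀) ε x) (abs_nonneg _) hK)
  have hDm : Measurable fun x : Fin n → T3 => (posDomain ε n).indicator
      (fun x => ∑ i, a' κ₀ (x i) * ∏ j ∈ univ.erase i, a κ₀ (x j)) x := by
    refine (Finset.measurable_sum _ fun i _ => ?_).indicator (measurableSet_posDomain ε n)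
    exact ((ha'_cont κ₀ hκ₀).measurable.comp (measurable_pi_apply i)).mul
      (Finset.measurable_prod _ fun j _ => (ha_cont κ₀ hκ₀).measurable.comp (measurable_pi_apply j))
  have i2 : Integrable (fun x : Fin n → T3 => F κ₀ x * (posDomain ε n).indicator
      (fun x => ∑ i, a' κ₀ (x i) * ∏ j ∈ univ.erase i, a κ₀ (x j)) x) :=
    Integrable.mono' (integrable_const (K * (n * C ^ n))) ((hFm κ₀ hκ₀).mul hDm).aestronglyMeasurable
      (ae_of_all _ fun x => by
        rw [Real.norm_eq_abs, abs_mul]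
        exact mul_le_mul (hFK κ₀ hκ₀ x) (abs_indicator_sum_mul_prod_erase_le hC (hbd κ₀ hκ₀) (hbd' κ₀ hκ₀) ε x)
          (abs_nonneg _) hK)
  have hN' : HasDerivAt (fun κ => ∫ x, F κ x * posWeight (a κ) ε n x)
      ((∫ x, F' κ₀ x * posWeight (a κ₀) ε n x) +
        ∫ x, (F κ₀ x * ∑ i, a' κ₀ (x i) / a κ₀ (x i)) * posWeight (a κ₀) ε n x) κ₀ := by
    refine hN.congr_deriv ?_
    rw [integral_add i1 i2]
    congr 1
    refine integral_congr_ae (ae_of_all _ fun x => ?_)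
    simp only
    rw [indicator_sum_mul_prod_erase_eq hpos ε x, mul_assoc]
  -- the partition function
  have hZ' : HasDerivAt (fun κ => posPartition (a κ) ε n)
      (∫ x, (1 : ℝ) * (∑ i, a' κ₀ (x i) / a κ₀ (x i)) * posWeight (a κ₀) ε n x) κ₀ := by
    have h := hasDerivAt_integral_mul_posWeight' (n := n) hr hC ha_cont ha'_cont hderiv hbd hbd' hpos
      (F := fun _ => (1 : ℝ)) measurable_const (K := 1) (fun _ => by simp) ε
    refine h.congr_of_eventuallyEq (Eventually.of_forall fun κ => ?_)
    simp [posPartition]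
  -- the quotient
  have hquot := hN'.div hZ' hZ.ne'
  have hfun : (fun κ => ∫ x, F κ x ∂posGibbsMeasure (a κ) ε n) =ᶠ[𝓝 κ₀]
      fun κ => (∫ x, F κ x * posWeight (a κ) ε n x) / posPartition (a κ) ε n := by
    filter_upwards [hball] with κ hκ
    rw [integral_posGibbsMeasure_eq (ha_cont κ hκ) (hnn κ hκ) ε n (F κ), div_eq_inv_mul]
  refine (hquot.congr_of_eventuallyEq hfun).congr_deriv ?_
  -- identification of the derivative
  rw [integral_posGibbsMeasure_eq (ha_cont κ₀ hκ₀) (hnn κ₀ hκ₀) ε n (F' κ₀),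
    integral_posGibbsMeasure_eq (ha_cont κ₀ hκ₀) (hnn κ₀ hκ₀) ε n (fun x => F κ₀ x * ∑ i, a' κ₀ (x i) / a κ₀ (x i)),
    integral_posGibbsMeasure_eq (ha_cont κ₀ hκ₀) (hnn κ₀ hκ₀) ε n (F κ₀),
    integral_posGibbsMeasure_eq (ha_cont κ₀ hκ₀) (hnn κ₀ hκ₀) ε n (fun x => ∑ i, a' κ₀ (x i) / a κ₀ (x i))]
  simp only [one_mul]
  have hZne := hZ.ne'
  field_simp
  ring

end Summit.AtomisticToContinuum.HydrodynamicLimit.Theorems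

end
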